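import Summits.QuantumFields.YangMills.Theorems.FirstExitWindowHistoryTailOfFirstExit
import Summits.QuantumFields.YangMills.Theorems.FirstExitWindowOneStepWindowL

/-!
# Route `UnitScaleTilt` — crux K2′ `HistoryTailL` (stmt-QuantumFields-19936) FROM THE FIRST-EXIT WINDOW TAIL of route `FirstExitWindow` ALONE
# (support file; width seat `ym-line-sfw-p2-w2` gen 16 of the `SmallFieldWidening` line, whose crux r3 is blocked on the same K2 content)

Route `FirstExitWindow`'s glue `HistoryTailOfFirstExit` (stmt-QuantumFields-26245, `firstExitWindow_historyTailOfFirstExit_proof`) and window `OneStepWindowL`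
(stmt-QuantumFields-26244, `firstExitWindow_oneStepWindowL_proof`) are PROVED; their composition is the parent crux BY NAME from the one open crux:
`FirstExitWindowTailL → UnitScaleTilt.HistoryTailL` — the K2′ estimate of route `UnitScaleTilt` (summable history tails with the free top fraction `1/m`, every
`m ≥ 1`, profile above any floor) is downstream of the windowed first-exit tail (stmt-QuantumFields-26243) alone, a feeder disjoint from the (α)-record chain
(`stub_laneRecordsV3Chi` / `AlphaInputsT3ACv3RecChi`).

WHAT THIS IS NOT: `FirstExitWindowTailL` is open — a conditional certificate; no large-field estimate is proved, the parent route's K1 cruxes are untouched, rung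
R3 (`YM3TorusSU2`) is a RECORD rung, not the Clay statement, and nothing here bears on the Yang–Mills mass gap.

References: T. Bałaban, CMP 102 (1985) 255–275 [Balaban1985UV3] ((7) p.257, (71) p.273); J. Fröhlich, R. Israel, E. Lieb, B. Simon, CMP 62 (1978) 1–34
[FrohlichIsraelLiebSimon1978].
-/

namespace Summit.QuantumFields.YangMills.Theorems

/-- **K2′ `HistoryTailL` ⇐ THE FIRST-EXIT WINDOW TAIL ALONE**: `FirstExitWindowTailL → UnitScaleTilt.HistoryTailL` (glue `firstExitWindow_historyTailOfFirstExit_proof`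
at the proved window `firstExitWindow_oneStepWindowL_proof`).  Conditional certificate for stmt-QuantumFields-19936 on stmt-QuantumFields-26243; nothing about the
mass gap. [cite: Balaban1985UV3, (7) p.257 and (71) p.273] -/
theorem unitScaleTilt_historyTailL_of_firstExitWindowTailL
    (hF : Summit.QuantumFields.YangMills.Theses.FirstExitWindow.FirstExitWindowTailL) :
    Summit.QuantumFields.YangMills.Theses.UnitScaleTilt.HistoryTailL :=
  firstExitWindow_historyTailOfFirstExit_proof firstExitWindow_oneStepWindowL_proof hF

end Summit.QuantumFields.YangMills.Theorems
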